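import Summits.Ventures.GridStability.Models.StructurePreservingLurieRoa

/-!
# GridStability/Models/StructurePreservingLurieLevel — the rank-one level facts of the SP / Lur'e lane
# come FOR FREE from the certificate's own coercivity `P ⪰ ε·1` (kernel filing cost of an SP–Lur'e
# certificate = the TWO matrix facts of `QuadraticCertificate`, nothing per line)

LADDER-GRIDFUSION G3 (model register) / G2 «SP–Lur'e lane», seat gridfusion-model-2 (g6); companion
of `StructurePreservingLurie.lean` / `StructurePreservingLurieRoa.lean`; `plan/MODEL-VALIDITY.md`
row **MV-3**. Written for the lead's filing-cost question (rulings R-QLMI / R-SPCERT,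
2026-08-27T04:08:54Z: «the count of facts, not their size, is the filing cost»).

THE POINT. Lit-6's kernel form of [cite: VuTuritsyn2017, §4.3 Theorem 1]
(`QuadraticCertificate.well_subset_regionOfAttraction_of_rankOne`) takes, besides the exact
`Λ = (P, g, ε)` with its two positive-semidefiniteness facts, ONE rank-one fact
`s_k·P − C_kᵀC_k ⪰ 0` PER LINE (56 facts of size 58 × 58 for «G2.b-SP NE39»). For the relative
structure-preserving object `Params.relLurie` every output row `C_e` has at most two non-zero
entries `±1` (`relLurie_C_dotProduct_self_le_two`), so with `s := 2/ε` the rank-one facts follow from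
`P − ε·1 ⪰ 0` by Cauchy–Schwarz (`posSemidef_smul_sub_vecMulVec_of_le`, `relLurie_rankOne_of_eps`),
and the certified level becomes the closed form `c < ε·(π/2 − |δ*_e|)²/2`
(`tendsto_relState_of_quadraticCertificate_of_eps`). A producer may still supply sharper `s_e`
(Schur complements `C_e P⁻¹ C_eᵀ ≤ 2/ε`) for a larger level through the `_of_rankOne` route; this
file is the floor that needs no per-line kernel fact.

THREE COLUMNS: MODELLED column only (typing lemmas about MODEL MV-3 in lit-6's vocabulary); no
certificate is produced or assumed to exist here; nothing says a grid is stable.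
MODELLED: absent effects = MODEL-VALIDITY MV-3; reference bus = bookkeeping.
-/

noncomputable section

open Finset Real Set Filter Matrix
open scoped Topology
open Literature.MathematicalPhysics.PowerSystems
open Literature.MathematicalPhysics.PowerSystems.LyapunovFunctionFamily

namespace Summit.Ventures.GridStability.Models.StructurePreserving

/-! ## Rank-one facts from coercivity (any bilinear system) -/

section RankOne

variable {ι κ : Type*} [Fintype ι] [Fintype κ] [DecidableEq ι] {S : System ι κ}

/-- **Rank-one level facts from the certified coercivity.** If `P − ε·1 ⪰ 0` (a field of every
`QuadraticCertificate`) and `cᵀc ≤ s·ε`, then `s·P − c cᵀ ⪰ 0`: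
`xᵀ(sP − ccᵀ)x = s·xᵀPx − (cᵀx)² ≥ s·ε·|x|² − |c|²|x|² ≥ 0` (Cauchy–Schwarz).
[cite: VuTuritsyn2017, §4.3 eq. (V_min) (the rank-one facts behind the certified level)] -/
theorem posSemidef_smul_sub_vecMulVec_of_le (Λ : QuadraticCertificate S) {s : ℝ} {c : ι → ℝ}
    (h : c ⬝ᵥ c ≤ s * Λ.ε) : (s • Λ.P - Matrix.vecMulVec c c).PosSemidef := by
  have hcc : 0 ≤ c ⬝ᵥ c := by
    simp only [dotProduct]
    exact Finset.sum_nonneg fun i _ => mul_self_nonneg (c i)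
  have hs : 0 ≤ s :=
    le_of_mul_le_mul_right (by rw [zero_mul]; exact hcc.trans h) Λ.ε_pos
  refine Matrix.PosSemidef.of_dotProduct_mulVec_nonneg ?_ fun x => ?_
  · show (s • Λ.P - Matrix.vecMulVec c c)ᴴ = s • Λ.P - Matrix.vecMulVec c c
    rw [Matrix.conjTranspose_eq_transpose_of_trivial, Matrix.transpose_sub, Matrix.transpose_smul,
      Λ.P_symm, Matrix.transpose_vecMulVec]
  · have hV := Λ.le_V x
    have hxx : 0 ≤ x ⬝ᵥ x := by
      simp only [dotProduct]
      exact Finset.sum_nonneg fun i _ => mul_self_nonneg (x i)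
    have hq : x ⬝ᵥ (Matrix.vecMulVec c c *ᵥ x) = (c ⬝ᵥ x) ^ 2 := by
      have hr : Matrix.vecMulVec c c *ᵥ x = fun i => c i * (c ⬝ᵥ x) := by
        funext i
        simp [Matrix.mulVec, dotProduct, Matrix.vecMulVec, Finset.mul_sum, mul_assoc]
      rw [hr]
      have e1 : (x ⬝ᵥ fun i => c i * (c ⬝ᵥ x)) = (∑ i, x i * c i) * (c ⬝ᵥ x) := by
        simp only [dotProduct, Finset.sum_mul]
        refine Finset.sum_congr rfl fun i _ => ?_
        ring
      rw [e1, sq]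
      congr 1
      simp only [dotProduct]
      refine Finset.sum_congr rfl fun i _ => ?_
      ring
    have hcs : (c ⬝ᵥ x) ^ 2 ≤ (c ⬝ᵥ c) * (x ⬝ᵥ x) := by
      have h' := Finset.sum_mul_sq_le_sq_mul_sq Finset.univ c x
      simpa only [dotProduct, sq] using h'
    have h1 : s * (Λ.ε * (x ⬝ᵥ x)) ≤ s * Λ.V x := mul_le_mul_of_nonneg_left hV hs
    have h2 : (c ⬝ᵥ c) * (x ⬝ᵥ x) ≤ s * Λ.ε * (x ⬝ᵥ x) := mul_le_mul_of_nonneg_right h hxx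
    rw [star_trivial, Matrix.sub_mulVec, Matrix.smul_mulVec, dotProduct_sub, dotProduct_smul,
      smul_eq_mul, hq]
    unfold QuadraticCertificate.V at h1
    nlinarith [h1, h2, hcs]

/-- The uniform constant `s = K/ε` works for every row `c` with `cᵀc ≤ K`. -/
theorem posSemidef_div_smul_sub_vecMulVec (Λ : QuadraticCertificate S) {K : ℝ} {c : ι → ℝ}
    (h : c ⬝ᵥ c ≤ K) : ((K / Λ.ε) • Λ.P - Matrix.vecMulVec c c).PosSemidef :=
  posSemidef_smul_sub_vecMulVec_of_le Λ (by rwa [div_mul_cancel₀ K Λ.ε_pos.ne'])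

end RankOne

/-! ## The output rows of the relative structure-preserving object have `C_eᵀC_e ≤ 2` -/

variable {k g m : ℕ}

/-- `inc_e(v)² ≤ [src e = v] + [tgt e = v]` (incidence numbers are `0, ±1`). -/
theorem edgeInc_sq_le (src tgt : Fin m → Fin (k + 1)) (e : Fin m) (v : Fin (k + 1)) :
    edgeInc src tgt e v ^ 2 ≤ (if src e = v then 1 else 0) + (if tgt e = v then 1 else 0) := by
  unfold edgeInc
  split_ifs <;> norm_num

/-- `Σ_v inc_e(v)² ≤ 2`: a listed line touches at most two buses. -/
theorem sum_edgeInc_sq_le_two (src tgt : Fin m → Fin (k + 1)) (e : Fin m) :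
    ∑ v, edgeInc src tgt e v ^ 2 ≤ 2 := by
  calc ∑ v, edgeInc src tgt e v ^ 2
      ≤ ∑ v : Fin (k + 1), ((if src e = v then (1 : ℝ) else 0) + (if tgt e = v then 1 else 0)) :=
        Finset.sum_le_sum fun v _ => edgeInc_sq_le src tgt e v
    _ = 2 := by
        rw [Finset.sum_add_distrib, Finset.sum_ite_eq, Finset.sum_ite_eq]
        simp only [Finset.mem_univ, if_true]
        norm_num

namespace Params

variable (p : Params (k + 1)) (r : Fin (k + 1)) (gnode : Fin g → Fin (k + 1))
  (src tgt : Fin m → Fin (k + 1)) (wt : Fin m → ℝ) (δs : Fin (k + 1) → ℝ)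

/-- **Every output row of the relative object has `C_eᵀC_e ≤ 2`**: `C = [E_rel 0]` reads
`θ̃_{src e} − θ̃_{tgt e}`, so row `e` carries `+1` at `src e` and `−1` at `tgt e` when these are not
the reference bus, and nothing else. [cite: VuTuritsyn2017, §2 (display for C)] -/
theorem relLurie_C_dotProduct_self_le_two (e : Fin m) :
    (p.relLurie r gnode src tgt wt δs).C e ⬝ᵥ (p.relLurie r gnode src tgt wt δs).C e ≤ 2 := by
  have hsplit : (p.relLurie r gnode src tgt wt δs).C e ⬝ᵥ (p.relLurie r gnode src tgt wt δs).C e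
      = ∑ i : Fin k, edgeInc src tgt e (r.succAbove i) ^ 2 := by
    simp [relLurie, relC, dotProduct, Fintype.sum_sum_type, sq]
  rw [hsplit]
  have hle : ∑ i : Fin k, edgeInc src tgt e (r.succAbove i) ^ 2 ≤ ∑ v, edgeInc src tgt e v ^ 2 := by
    rw [Fin.sum_univ_succAbove (fun v => edgeInc src tgt e v ^ 2) r]
    linarith [sq_nonneg (edgeInc src tgt e r)]
  exact hle.trans (sum_edgeInc_sq_le_two src tgt e)

/-- **Rank-one facts for the relative object from the certificate alone**: with `s := 2/ε`,
`s·P − C_eᵀC_e ⪰ 0` for every listed line — no per-line kernel fact is needed.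
[cite: VuTuritsyn2017, §4.3 eq. (V_min)] -/
theorem relLurie_rankOne_of_eps (Λ : QuadraticCertificate (p.relLurie r gnode src tgt wt δs))
    (e : Fin m) :
    ((2 / Λ.ε) • Λ.P - Matrix.vecMulVec ((p.relLurie r gnode src tgt wt δs).C e)
      ((p.relLurie r gnode src tgt wt δs).C e)).PosSemidef :=
  posSemidef_div_smul_sub_vecMulVec Λ (relLurie_C_dotProduct_self_le_two p r gnode src tgt wt δs e)

variable {p r gnode src tgt wt δs}

/-- **The certified level from `ε` alone**: every `c` with `2c < ε·(π/2 − |δ*_e|)²` for all listed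
lines lies below `V` on the frontier of the sector polytope (the `V_min` bound with `s_e = 2/ε`).
[cite: VuTuritsyn2017, §4.3 eq. (V_min)] -/
theorem relLurie_lt_V_frontier_of_eps (Λ : QuadraticCertificate (p.relLurie r gnode src tgt wt δs))
    (hδs : ∀ e, |δs (src e) - δs (tgt e)| < π / 2)
    {c : ℝ} (hc : ∀ e, 2 * c < Λ.ε * (π / 2 - |δs (src e) - δs (tgt e)|) ^ 2) :
    ∀ x ∈ frontier (p.relLurie r gnode src tgt wt δs).halfPolytope, c < Λ.V x := by
  intro x hx
  refine Λ.lt_V_of_mem_frontier_halfPolytope hδs (s := fun _ => 2 / Λ.ε)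
    (fun _ => div_pos two_pos Λ.ε_pos) (fun e => relLurie_rankOne_of_eps p r gnode src tgt wt δs Λ e)
    (fun e => ?_) hx
  -- `c < (π/2 − |δ*_e|)² / (2/ε)`
  rw [lt_div_iff₀ (div_pos two_pos Λ.ε_pos)]
  have hε := Λ.ε_pos
  have h := hc e
  have hrw : c * (2 / Λ.ε) * Λ.ε = 2 * c := by field_simp
  show c * (2 / Λ.ε) < (π / 2 - |δs (src e) - δs (tgt e)|) ^ 2
  have key : c * (2 / Λ.ε) * Λ.ε < (π / 2 - |δs (src e) - δs (tgt e)|) ^ 2 * Λ.ε := by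
    rw [hrw]; linarith
  exact lt_of_mul_lt_mul_right key hε.le

/-- **Theorem 1 for MV-3 with the `ε`-level** (no rank-one facts): for well-formed data with
`P⁰ = f(δ*)`, reference load bus `r ∉ gen`, an injective enumeration of `gen`, edge-list couplings with
a preconnected coupling graph, an exact quadratic certificate `Λ = (P, g, ε)` on the relative object
with `|δ*_e| < π/2`, STRICT gains `g < g⋆(δ*_e)` and a level `c` with `2c < ε·(π/2 − |δ*_e|)²` on every
listed line: every phase solution of MV-3 whose initial listed line angles lie in `(−π/2, π/2)` and
with `V(relState(X 0)) ≤ c` keeps both for all `t ≥ 0`, and its relative state tends to `0`.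
CERTIFIED given `Λ`; MODEL MV-3; inner estimate. [cite: VuTuritsyn2017, §4.3 Theorem 1 with eq. (V_min)] -/
theorem tendsto_relState_of_quadraticCertificate_of_eps (hp : p.WellFormed) (hr : r ∉ p.gen)
    (hginj : Function.Injective gnode) (hgen : ∀ v, v ∈ p.gen ↔ ∃ j, gnode j = v)
    (hb : p.b = symmetrize (edgeWeight src tgt wt)) (hconn : p.couplingGraph.Preconnected)
    (hP : ∀ v, p.pe δs v = p.P0 v)
    (Λ : QuadraticCertificate (p.relLurie r gnode src tgt wt δs))
    (hδs : ∀ e, |δs (src e) - δs (tgt e)| < π / 2)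
    (hg : ∀ e, Λ.g < sectorGain (δs (src e) - δs (tgt e)))
    {c : ℝ} (hc : ∀ e, 2 * c < Λ.ε * (π / 2 - |δs (src e) - δs (tgt e)|) ^ 2)
    {X : ℝ → (Fin (k + 1) → ℝ) × (Fin (k + 1) → ℝ)}
    (hX : ∀ T : ℝ, ∀ t ∈ Icc 0 T, HasDerivWithinAt X (p.phaseField (X t)) (Icc 0 T) t)
    (h0 : ∀ e, |(X 0).1 (src e) - (X 0).1 (tgt e)| < π / 2)
    (hVc : Λ.V (relState r gnode δs (X 0)) ≤ c) :
    (∀ t, 0 ≤ t → (∀ e, |(X t).1 (src e) - (X t).1 (tgt e)| < π / 2) ∧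
        Λ.V (relState r gnode δs (X t)) ≤ c) ∧
      Tendsto (fun t => relState r gnode δs (X t)) atTop (𝓝 0) :=
  tendsto_relState_of_quadraticCertificate hp hr hginj hgen hb hconn hP Λ hδs hg
    (relLurie_lt_V_frontier_of_eps Λ hδs hc) hX h0 hVc

end Params

end Summit.Ventures.GridStability.Models.StructurePreserving

end
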